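import Summits.Ventures.HodgeRepro2.T5AdicCompletionGaloisInvariance
import Summits.Ventures.HodgeRepro2.T5InertPlaceCompletion

/-!
# T5LocalConjugationRestriction — the non-trivial automorphism of `L_w / K_v` restricts to the
non-trivial automorphism of the quadratic `L / K`: the local star IS the global CM conjugation

Tier-5 kernel support (N3, the inert places) — p8, gen 15.  §8(d): uses an L-value-free
non-vanishing device: NO.

Every inert-place statement takes the star on `E_v = L_w` to be SOME non-trivial automorphism
`σ` of `L_w / K_v`.  The record's star is the CM conjugation `τ` of `E / F`.  They agree: for a
quadratic `L / K` and any `σ ≠ 1` in `Gal(L_w / K_v)`,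
* `exists_restrict` — `σ` restricts to an automorphism of `L / K` (Mathlib's
  `AlgEquiv.restrictNormal`, `L / K` being Galois);
* `restrict_ne_one` — the restriction is non-trivial (else `σ` fixes the dense image of `L`,
  hence everything: `DenseRange.equalizer` with the continuity of `σ`, p4's
  `continuous_algEquiv`);
* `apply_algebraMap_eq` — **`σ (ι x) = ι (τ x)`** for every `x ∈ L` and the non-trivial
  `τ ∈ Gal(L / K)` (`Gal(L / K)` has exactly two elements);
* `ext_of_apply_algebraMap_eq` — a local automorphism is determined by its values on `L`;
  `card_algEquiv_eq_two` / `eq_of_ne_one` — at a place of local degree `2` the local Galois group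
  is `{1, σ}`: the star of the inert-place package is unique.
-/

namespace Summit.Ventures.HodgeRepro2.T5LocalConjugationRestriction

open IsDedekindDomain HeightOneSpectrum NumberField

/-- In a group of order `2`, any two non-identity elements coincide. -/
theorem eq_of_ne_one_of_card_eq_two {G : Type*} [Group G] (hG : Nat.card G = 2) {a b : G}
    (ha : a ≠ 1) (hb : b ≠ 1) : a = b := by
  obtain ⟨x, y, _, hU⟩ := Nat.card_eq_two_iff.1 hG
  have hmem : ∀ g : G, g = x ∨ g = y := fun g => by
    have : g ∈ ({x, y} : Set G) := hU ▸ Set.mem_univ g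
    simpa using this
  rcases hmem 1 with h1 | h1 <;> rcases hmem a with ha' | ha' <;> rcases hmem b with hb' | hb'
  all_goals first
    | exact absurd (ha'.trans h1.symm) ha
    | exact absurd (hb'.trans h1.symm) hb
    | exact ha'.trans hb'.symm

variable {K : Type*} [Field K] [NumberField K] (v : HeightOneSpectrum (RingOfIntegers K))
variable {L : Type*} [Field L] [NumberField L] [Algebra K L]
  (w : HeightOneSpectrum (RingOfIntegers L)) [w.asIdeal.LiesOver v.asIdeal]

/-- Every `K_v`-automorphism of `L_w` restricts to a `K`-automorphism of `L`. -/
theorem exists_restrict (h2 : Module.finrank K L = 2)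
    (σ : w.adicCompletion L ≃ₐ[v.adicCompletion K] w.adicCompletion L) :
    ∃ τ : L ≃ₐ[K] L, ∀ x : L,
      σ (algebraMap L (w.adicCompletion L) x) = algebraMap L (w.adicCompletion L) (τ x) := by
  haveI : Algebra.IsQuadraticExtension K L := ⟨h2⟩
  haveI := Algebra.IsQuadraticExtension.isGalois K L
  exact ⟨(σ.restrictScalars K).restrictNormal L, fun x =>
    (AlgEquiv.restrictNormal_commutes (σ.restrictScalars K) L x).symm⟩

/-- A non-trivial `K_v`-automorphism of `L_w` does not fix the image of `L` pointwise: the image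
is dense and `σ` is continuous. -/
theorem exists_apply_algebraMap_ne (σ : w.adicCompletion L ≃ₐ[v.adicCompletion K] w.adicCompletion L)
    (hσ : σ ≠ 1) :
    ∃ x : L, σ (algebraMap L (w.adicCompletion L) x) ≠ algebraMap L (w.adicCompletion L) x := by
  by_contra h
  push Not at h
  apply hσ
  have heq : (⇑σ : w.adicCompletion L → w.adicCompletion L) = id :=
    DenseRange.equalizer (denseRange_algebraMap L w)
      (T5AdicCompletionGaloisInvariance.continuous_algEquiv v w σ) continuous_id (funext h)
  exact AlgEquiv.ext fun x => congrFun heq x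

/-- THE LOCAL STAR IS THE GLOBAL CONJUGATION: for `L / K` quadratic, `σ ≠ 1` in `Gal(L_w / K_v)`
and `τ ≠ 1` in `Gal(L / K)`, `σ (ι x) = ι (τ x)` for every `x ∈ L`. -/
theorem apply_algebraMap_eq (h2 : Module.finrank K L = 2)
    (σ : w.adicCompletion L ≃ₐ[v.adicCompletion K] w.adicCompletion L) (hσ : σ ≠ 1)
    (τ : L ≃ₐ[K] L) (hτ : τ ≠ 1) (x : L) :
    σ (algebraMap L (w.adicCompletion L) x) = algebraMap L (w.adicCompletion L) (τ x) := by
  haveI : Algebra.IsQuadraticExtension K L := ⟨h2⟩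
  haveI := Algebra.IsQuadraticExtension.isGalois K L
  obtain ⟨τ', hτ'⟩ := exists_restrict v w h2 σ
  have hne : τ' ≠ 1 := by
    rintro rfl
    obtain ⟨y, hy⟩ := exists_apply_algebraMap_ne v w σ hσ
    exact hy (by rw [hτ' y]; rfl)
  have hcard : Nat.card (L ≃ₐ[K] L) = 2 := by
    rw [IsGalois.card_aut_eq_finrank, h2]
  rw [hτ' x, eq_of_ne_one_of_card_eq_two hcard hne hτ]

/-- The global conjugation `τ` of `L / K` is the restriction of every non-trivial local
automorphism: the star of the inert-place package, whichever `σ ≠ 1` is chosen, acts on the image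
of `L` as the record's CM conjugation. -/
theorem apply_algebraMap_eq_of_ne_one (h2 : Module.finrank K L = 2) (τ : L ≃ₐ[K] L) (hτ : τ ≠ 1) :
    ∀ (σ : w.adicCompletion L ≃ₐ[v.adicCompletion K] w.adicCompletion L), σ ≠ 1 →
      ∀ x : L, σ (algebraMap L (w.adicCompletion L) x) = algebraMap L (w.adicCompletion L) (τ x) :=
  fun σ hσ x => apply_algebraMap_eq v w h2 σ hσ τ hτ x

/-- A `K_v`-automorphism of `L_w` is determined by its values on the (dense) image of `L`. -/
theorem ext_of_apply_algebraMap_eq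
    (σ σ' : w.adicCompletion L ≃ₐ[v.adicCompletion K] w.adicCompletion L)
    (h : ∀ x : L, σ (algebraMap L (w.adicCompletion L) x) = σ' (algebraMap L (w.adicCompletion L) x)) :
    σ = σ' := by
  have heq : (⇑σ : w.adicCompletion L → w.adicCompletion L) = ⇑σ' :=
    DenseRange.equalizer (denseRange_algebraMap L w)
      (T5AdicCompletionGaloisInvariance.continuous_algEquiv v w σ)
      (T5AdicCompletionGaloisInvariance.continuous_algEquiv v w σ') (funext h)
  exact AlgEquiv.ext fun x => congrFun heq x

/-- At a place of local degree `2` the local Galois group has exactly two elements. -/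
theorem card_algEquiv_eq_two
    (h2 : Module.finrank (v.adicCompletion K) (w.adicCompletion L) = 2) :
    Nat.card (w.adicCompletion L ≃ₐ[v.adicCompletion K] w.adicCompletion L) = 2 := by
  haveI := T5InertPlaceCompletion.isGalois_adicCompletion v w h2
  rw [IsGalois.card_aut_eq_finrank, h2]

/-- At a place of local degree `2` the non-trivial local automorphism is unique. -/
theorem eq_of_ne_one (h2 : Module.finrank (v.adicCompletion K) (w.adicCompletion L) = 2)
    {σ σ' : w.adicCompletion L ≃ₐ[v.adicCompletion K] w.adicCompletion L} (hσ : σ ≠ 1)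
    (hσ' : σ' ≠ 1) : σ = σ' :=
  eq_of_ne_one_of_card_eq_two (card_algEquiv_eq_two v w h2) hσ hσ'

end Summit.Ventures.HodgeRepro2.T5LocalConjugationRestriction
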